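import Literature.AlgebraicGeometry.Modules.BoxTensor
import Literature.AlgebraicGeometry.Modules.TensorSheafHomAdjunction
import Literature.AlgebraicGeometry.Modules.TensorBraiding
import Literature.AlgebraicGeometry.Modules.InvertibleModule
import Literature.AlgebraicGeometry.KTheory.PullbackVectorBundle
import HarnessLib

/-!
# `M ↦ M ⊠ N = p^*M ⊗ q^*N` is exact for `N` a vector bundle and `p` flat (the «rows» of the box of resolutions)

Layer `Literature/AlgebraicGeometry/Modules`. For a span `p : Z ⟶ X`, `q : Z ⟶ Y` of schemes, a FINITE LOCALLY FREE `𝒪_Y`-module `N` and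
`p^*` left exact (`[PreservesFiniteLimits (Scheme.Modules.pullback p)]`, e.g. `p` flat: `Modules/PullbackStalk.preservesFiniteLimits_pullback_of_flat`),
the functor `(boxTensorFunctor p q).flip.obj N : X.Modules ⥤ Z.Modules`, `M ↦ M ⊠ N = p^*M ⊗ q^*N`, is EXACT. Proof (0 named facts): tensoring
with a finite locally free module preserves monomorphisms (`Modules/TensorSheafHomAdjunction.preservesMonomorphisms_tensorBifunctor_obj`) and is
a left adjoint, hence exact (`preservesFiniteLimits_tensorBifunctor_obj_of_isFiniteLocallyFree`); `M ⊠ N ≅ q^*N ⊗ p^*M` naturally in `M`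
(the braiding `Modules/TensorBraiding.tensorComm`), i.e. `(boxTensorFunctor p q).flip.obj N ≅ p^* ⋙ (q^*N ⊗ –)` (`boxTensorFlipIso`); compose.

* `preservesFiniteLimits_tensorBifunctor_obj_of_isFiniteLocallyFree`, `preservesFiniteColimits_tensorBifunctor_obj`, `preservesHomology_…`;
* `boxTensorFlipIso p q N : (boxTensorFunctor p q).flip.obj N ≅ Scheme.Modules.pullback p ⋙ (tensorBifunctor Z).obj ((Scheme.Modules.pullback q).obj N)`;
* **`preservesFiniteLimits_boxTensorFunctor_flip_obj`**, `preservesFiniteColimits_boxTensorFunctor_flip_obj`, **`preservesHomology_boxTensorFunctor_flip_obj`**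
  (theorems, bind with `haveI`); and the companion identification `(boxTensorFunctor p q).obj M = p^*M ⊗ q^*(–)` (`rfl`).

Use (cell `pub-hodge-ring2`, crux 26512, 0-fact lane [BOX-RES]: the rows `R• ⊠ Sʲ → G ⊠ Sʲ` of the box of two strictly perfect resolutions are
quasi-isomorphisms; the columns are `Modules/BoxTensorExact`); library only; no instances.

## References

* The Stacks Project, Tag 0FXX (`K ⊠ M`), Tag 01CA (Lemma 17.16.1), Tag 05P2 context (tensoring with finite locally free is exact). [StacksProject]
* R. Hartshorne, *Algebraic Geometry* (1977), III Prop. 9.2 (flat pull-back), II Ex. 5.1. [Hartshorne1977]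
-/

noncomputable section

-- `TopCat.Presheaf`/`Scheme.Modules` are not reducible (as in Mathlib's `AlgebraicGeometry/Modules`).
set_option backward.isDefEq.respectTransparency false

open CategoryTheory CategoryTheory.Limits AlgebraicGeometry

universe u

namespace Literature.AlgebraicGeometry.Modules

open Literature.AlgebraicGeometry.Motives

/-! ### §1 Tensoring with a finite locally free module is exact -/

section Tensor

variable {X : Scheme.{u}} {L : X.Modules}

/-- `L ⊗ –` preserves finite colimits (it is a left adjoint, `tensorSheafHomAdj`). [cite: StacksProject, Tag 01CA] -/
theorem preservesFiniteColimits_tensorBifunctor_obj (L : X.Modules) : PreservesFiniteColimits ((tensorBifunctor X).obj L) :=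
  haveI := isLeftAdjoint_tensorBifunctor_obj (X := X) L
  inferInstance

/-- **`L ⊗ –` is left exact for `L` finite locally free** (it preserves monomorphisms and finite colimits).
[cite: StacksProject, Tag 01CA (with 05P2)] [cite: Hartshorne1977, II Ex. 5.1] -/
theorem preservesFiniteLimits_tensorBifunctor_obj_of_isFiniteLocallyFree (hL : IsFiniteLocallyFree L) :
    PreservesFiniteLimits ((tensorBifunctor X).obj L) :=
  haveI := additive_tensorBifunctor_obj (X := X) L
  haveI := preservesFiniteColimits_tensorBifunctor_obj L
  (Functor.preservesFiniteLimits_iff_forall_exact_map_and_mono _).mpr fun S hS =>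
    haveI := hS.mono_f
    ⟨((Functor.preservesFiniteColimits_iff_forall_exact_map_and_epi _).mp inferInstance S hS).1,
      (preservesMonomorphisms_tensorBifunctor_obj hL).preserves S.f⟩

/-- `L ⊗ –` is exact (preserves homology) for `L` finite locally free. [cite: StacksProject, Tag 01CA] -/
theorem preservesHomology_tensorBifunctor_obj_of_isFiniteLocallyFree (hL : IsFiniteLocallyFree L) :
    haveI := additive_tensorBifunctor_obj (X := X) L
    ((tensorBifunctor X).obj L).PreservesHomology :=
  haveI := additive_tensorBifunctor_obj (X := X) L
  haveI := preservesFiniteLimits_tensorBifunctor_obj_of_isFiniteLocallyFree hL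
  haveI := preservesFiniteColimits_tensorBifunctor_obj L
  inferInstance

end Tensor

/-! ### §2 `M ↦ M ⊠ N` for `N` finite locally free -/

section Box

variable {X Y Z : Scheme.{u}} (p : Z ⟶ X) (q : Z ⟶ Y) (N : Y.Modules)

/-- **`M ⊠ N ≅ q^*N ⊗ p^*M` naturally in `M`**: `(boxTensorFunctor p q).flip.obj N ≅ p^* ⋙ (q^*N ⊗ –)` (the braiding `tensorComm`).
[cite: StacksProject, Tag 01CA (Lemma 17.16.1, symmetry)] -/
def boxTensorFlipIso :
    (boxTensorFunctor p q).flip.obj N ≅ Scheme.Modules.pullback p ⋙ (tensorBifunctor Z).obj ((Scheme.Modules.pullback q).obj N) :=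
  NatIso.ofComponents (fun M => tensorComm ((Scheme.Modules.pullback p).obj M) ((Scheme.Modules.pullback q).obj N)) (fun {M M'} f => by
    change tensorMap ((Scheme.Modules.pullback p).map f) (𝟙 _) ≫ (tensorComm _ _).hom =
      (tensorComm _ _).hom ≫ tensorMap (𝟙 _) ((Scheme.Modules.pullback p).map f)
    rw [tensorMap_tensorComm_hom])

/-- `M ↦ M ⊠ N` is additive. [cite: StacksProject, Tag 0FXX] -/
theorem additive_boxTensorFunctor_flip_obj : ((boxTensorFunctor p q).flip.obj N).Additive :=
  ⟨fun {M M'} {f g} => by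
    haveI := additive_tensorBifunctor_obj (X := Z) ((Scheme.Modules.pullback q).obj N)
    change tensorMap ((Scheme.Modules.pullback p).map (f + g)) (𝟙 _) =
      tensorMap ((Scheme.Modules.pullback p).map f) (𝟙 _) + tensorMap ((Scheme.Modules.pullback p).map g) (𝟙 _)
    rw [← cancel_mono (tensorComm _ ((Scheme.Modules.pullback q).obj N)).hom, tensorMap_tensorComm_hom, Preadditive.add_comp,
      tensorMap_tensorComm_hom, tensorMap_tensorComm_hom, Functor.map_add, ← Preadditive.comp_add]
    congr 1
    exact ((tensorBifunctor Z).obj ((Scheme.Modules.pullback q).obj N)).map_add⟩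

/-- `M ↦ M ⊠ N` preserves finite colimits (pull-back and `q^*N ⊗ –` are left adjoints). [cite: StacksProject, Tag 0FXX] -/
theorem preservesFiniteColimits_boxTensorFunctor_flip_obj : PreservesFiniteColimits ((boxTensorFunctor p q).flip.obj N) :=
  haveI := preservesFiniteColimits_tensorBifunctor_obj ((Scheme.Modules.pullback q).obj N)
  preservesFiniteColimits_of_natIso (boxTensorFlipIso p q N).symm

variable {N}

/-- **`M ↦ M ⊠ N` is left exact for `N` finite locally free and `p^*` left exact** (e.g. `p` flat).
[cite: StacksProject, Tag 0FXX with Tag 01CA] [cite: Hartshorne1977, III Prop. 9.2] -/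
theorem preservesFiniteLimits_boxTensorFunctor_flip_obj [PreservesFiniteLimits (Scheme.Modules.pullback p)] (hN : IsFiniteLocallyFree N) :
    PreservesFiniteLimits ((boxTensorFunctor p q).flip.obj N) :=
  haveI := preservesFiniteLimits_tensorBifunctor_obj_of_isFiniteLocallyFree (hN.pullback q)
  preservesFiniteLimits_of_natIso (boxTensorFlipIso p q N).symm

/-- **`M ↦ M ⊠ N` is exact** (preserves homology, hence quasi-isomorphisms of complexes termwise) for `N` finite locally free and `p^*`
left exact. [cite: StacksProject, Tag 0FXX with Tag 01CA] -/
theorem preservesHomology_boxTensorFunctor_flip_obj [PreservesFiniteLimits (Scheme.Modules.pullback p)] (hN : IsFiniteLocallyFree N) :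
    haveI := additive_boxTensorFunctor_flip_obj p q N
    ((boxTensorFunctor p q).flip.obj N).PreservesHomology :=
  haveI := additive_boxTensorFunctor_flip_obj p q N
  haveI := preservesFiniteLimits_boxTensorFunctor_flip_obj p q hN
  haveI := preservesFiniteColimits_boxTensorFunctor_flip_obj p q N
  inferInstance

/-- The other variable: `(boxTensorFunctor p q).obj M` IS `q^* ⋙ (p^*M ⊗ –)` (`rfl`; its exactness over a field is
`Modules/BoxTensorExact.preservesHomology_boxLeftFunctor`). [cite: StacksProject, Tag 0FXX] -/
theorem boxTensorFunctor_obj_eq (M : X.Modules) :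
    (boxTensorFunctor p q).obj M = Scheme.Modules.pullback q ⋙ (tensorBifunctor Z).obj ((Scheme.Modules.pullback p).obj M) := rfl

end Box

end Literature.AlgebraicGeometry.Modules

end
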